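import Mathlib
import Summits.Ventures.HodgeRepro2.T6NAut
import Summits.Ventures.HodgeRepro2.T6N5Hyp
import Summits.Ventures.HodgeRepro2.T6N5Datum
import Summits.Ventures.HodgeRepro2.T6N5Main

/-!
# T6N5Wrap — `N5_main` over the M2 composition carrier `NAut` (TARGET-T6 v0.4 §9.3, row N5)

Tier 6 (README §10), sub-step N5 (t6-p7 with t6-p8).  The owner theorem the lead's
`periodInputN_of_published` consumes BY NAME: N5 for the carrier's N5 datum `M.d5` (t6-p7's
`N5Skeleton.N5Data`, NAut v1) from the displays of `T6N5Hyp` consumed by name and the residual binders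
of §9.5, then Proposition N*'s hypotheses (ii) on both sides through the carrier's compat fields
(`NAut.iiA_and_iiB_of_N5`).

BINDERS AND THEIR CLASSES (§9.5; counted on the M2 line):
* `hT : Hyp.BFGYYZ2025_Thm5_6 {M.d5.A, M.d5.B}` — the dichotomy of Theorem 5.4 (v1) = 5.6 (v2) on the
  two sides of the datum: `[residual: PO]` (published, Selecta print locator not held);
* `hL` — Lemma N5.L1 on both sides: discharged by `T6N5Level.exists_level_type_ne_zero` on the
  representation carrier (smoothness + equivariance of N3's datum) or `[residual: IR]`;
* `ha` — (a) on both sides: discharged by `N5Family.condA_of_def` (β′ := the right side of (a_A);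
  S-H from N2 (A5)) or `[residual: IR]` until `AdmDatum` is in NAut v2;
* `hb` — (b) on both sides: the finite non-split places from t6-p8's `N5Local_main` by name (N5.T2 /
  N5.T3 over p4's kernel with the GGP / Biswas displays), the real places `[residual: IR]` (MEMO
  §10.4(C) through Remark 5.7 + N3.T1);
* `hc : M.d5.condC` — (c) at the datum's twist: `[residual: EX; the datum's ν ∈ Ξ_𝔭 is one of the
  cofinitely many twists with L(½, ξ_a)L(½, ξ_b) ≠ 0 on both sides — in kernel,
  `N5Datum.Datum.exists_good_twist` / `N5Main.condC_of_displays` from the §G displays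
  `Hyp.Hsieh2014mu_ThmA` / `Hyp.BurungaleHida2017_ThmB` / `Hyp.Hsieh2014mu_Interp1_1` (class AC) and
  `N5Main.KernelHyps`; the CHOICE of ν is the datum's]`.
`N5_main_of_datum` states the same with the full N5 datum (`N5Datum.Datum`: the twist family and the
four Proposition-G branches) identified with `M.d5` at its twist, so that the §G displays are consumed
by name and `hc` is the only EX residual.  §8(d): uses an L-value-free non-vanishing device: NO.
-/

namespace Summit.Ventures.HodgeRepro2.T6.N5Wrap

open Summit.Ventures.HodgeRepro2.T6 Summit.Ventures.HodgeRepro2.T6.N5Skeleton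
  Summit.Ventures.HodgeRepro2.T6.N5PropG Summit.Ventures.HodgeRepro2.T6.N5Datum
  Summit.Ventures.HodgeRepro2.T6.N5Main Summit.Ventures.HodgeRepro2.T6.Hyp

variable {K : Type*} [Field K] [NumberField K] {F : FaceSetting K} {P : NDatum F}

/-- The two sides of the carrier's N5 datum — the set on which Theorem 5.6's display is consumed
(non-empty by construction). -/
def sidesOf (M : NAut F P) : Set (ToricSide M.ι5 M.G5) := {M.d5.A, M.d5.B}

/-- N5 FOR THE COMPOSITION CARRIER (§9.3 row N5): Theorem 5.6 on the datum's two sides [PO], Lemma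
N5.L1 ×2, (a) ×2, (b) ×2 and (c) at the datum's twist [EX] give `M.N5` = `M.d5.N5`. -/
theorem N5_main (M : NAut F P) (hT : BFGYYZ2025_Thm5_6 (sidesOf M))
    (hL : M.d5.A.levelReduction ∧ M.d5.B.levelReduction)
    (ha : M.d5.A.condA ∧ M.d5.B.condA) (hb : M.d5.A.condB ∧ M.d5.B.condB)
    (hc : M.d5.condC) : M.N5 :=
  N5Data.N5_of_residual (hT _ (Or.inl rfl)) (hT _ (Or.inr rfl)) hL.1 hL.2 ha.1 ha.2 hb.1 hb.2 hc

/-- Proposition N*'s hypotheses (ii) on both sides from `N5_main`, through the carrier's compat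
fields `hypII_A_of_N5` / `hypII_B_of_N5` (residual IR on the carrier). -/
theorem iiA_and_iiB (M : NAut F P) (hT : BFGYYZ2025_Thm5_6 (sidesOf M))
    (hL : M.d5.A.levelReduction ∧ M.d5.B.levelReduction)
    (ha : M.d5.A.condA ∧ M.d5.B.condA) (hb : M.d5.A.condB ∧ M.d5.B.condB)
    (hc : M.d5.condC) : M.iiA ∧ M.iiB :=
  M.iiA_and_iiB_of_N5 (N5_main M hT hL ha hb hc)

/-- The same with the FULL N5 datum `N : N5Datum.Datum` (the twist family + the four Proposition-G
branches) whose member at the datum's twist is the carrier's `M.d5`: Theorem 5.6 on all the family's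
sides, N5.L1 / (a) / (b) at the datum's twist, and (c) at the datum's twist [EX — `N.exists_good_twist`
/ `N5Main.condC_of_displays` from the §G displays witness that good twists exist] give `M.N5`. -/
theorem N5_main_of_datum (M : NAut F P) {Ξ ι' K' : Type*} [Field K']
    (N : Datum M.ι5 M.G5 Ξ ι' K') (hcur : N.current = M.d5)
    (hT : BFGYYZ2025_Thm5_6 (sides N))
    (hL : N.current.A.levelReduction ∧ N.current.B.levelReduction)
    (ha : N.current.A.condA ∧ N.current.B.condA) (hb : N.current.A.condB ∧ N.current.B.condB)
    (hc : N.current.condC) : M.N5 := by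
  have h := N5_main_fixed N hT hL ha hb hc
  unfold NAut.N5
  rw [← hcur]
  exact h

end Summit.Ventures.HodgeRepro2.T6.N5Wrap
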